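import Literature.AlgebraicGeometry.KTheory.Determinant
import Literature.AlgebraicGeometry.Modules.LineBundleOfCocycleClass
import Literature.AlgebraicGeometry.Modules.RankOneCocycleIso
import Literature.AlgebraicGeometry.Modules.PullbackFrame
import Literature.AlgebraicGeometry.Motives.WittSchemeSpecialFibreLocus
import HarnessLib

/-!
# `FormalLiftingFromClassLifting` (stmt-HodgeConjecture-13825) · the rank-one case of the residual
# stub S6: a line bundle whose determinant class extends has its `K₀`-class extending

Route `PadicSemiregularLift` of `HodgeConjecture`, crux P1a `FormalLiftingFromClassLifting`, line
`IdeatorFiveSketch` (weight-one-first skeleton of lead `prover-line-stmt-HodgeConjecture-13825-c1-0`).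
Its residual stub `stub_stepClassLiftingFromDetClass` (S6) asks, for a finite locally free lift `F` on
`X_{n+1}` whose determinant class `det[F] ∈ Ȟ¹(X_{n+1}, 𝒪^×)` is the restriction of a class on `X_{n+2}`,
that `[F] ∈ im(K₀(X_{n+2}) → K₀(X_{n+1}))`. For `F` of RANK ONE this holds on any morphism of schemes and
needs none of the crux's hypotheses — this file proves it, together with the rank bookkeeping that makes
the rank-one case of the crux reachable from the weight-one engine (`detClass_extends`):

* `frameSystem_rank_eq` — two frame systems of one module have the same rank at every point
  (invariant basis number over the non-trivial ring of sections of a non-empty open);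
* `hasRank_of_frameSystem_pullback` / `hasRank_of_hasRank_pullback_of_surjective` — **rank descends along
  a surjective morphism**: if `f : Y ⟶ Z` is surjective on points, `F` is finite locally free on `Z` and
  `f^* F` has rank `r`, then `F` has rank `r` (so every finite locally free lift of a rank-`r` bundle
  across a nilpotent thickening has rank `r`);
* `hasRank_of_iso`, `hasRank_of_pullback_specialFibreToThickening_iso` — rank is iso-invariant,
  `X_k ⟶ X_{n+1}` is onto (private copy of the `…TowerCocycles` lemma),
  hence every finite locally free lift of a rank-`r` `E₁` to `X_{n+1}` has rank `r`;
* `stepClassLifting_of_detClass_extends_of_hasRank_one` — **S6 in rank one**: for `f : Y ⟶ Z`, `F` finite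
  locally free of rank `1` on `Y` and `c' ∈ Ȟ¹(Z, 𝒪_Z^×)` with `f^* c' = det[F]`, the glued line bundle
  `L' = lineBundle c'` on `Z` has `f^*[L'] = [F]` in `K₀(Y)` (`f^* L' ≅ F`: rank-one framed modules with the
  same cocycle class are isomorphic, `nonempty_iso_of_cocycle_equiv`), hence
  `[F] ∈ im(K₀(Z) → K₀(Y))`; `exists_lineBundle_pullback_iso_of_detClass_extends` is the object form.

Everything is proved over the tree's Čech Picard group (`Modules/UnitCocycle*`), determinant class
(`Modules/DeterminantCocycle*`, `KTheory/Determinant`) and glued line bundles (`Modules/LineBundleOfCocycle*`);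
no definitions, no named facts.

References: R. Hartshorne, *Algebraic Geometry* (1977), II Ex. 6.11, III Ex. 4.5; W. Fulton,
*Intersection Theory* (1998), §15.1.
-/

set_option linter.dupNamespace false

noncomputable section

open CategoryTheory AlgebraicGeometry Opposite TopologicalSpace
open Literature.AlgebraicGeometry.Motives Literature.AlgebraicGeometry.Modules
open Literature.AlgebraicGeometry.KTheory

namespace Summit.HodgeConjecture.HodgeConjecture.Theorems.FormalLiftingFromClassLifting.WeightOne

universe u

/-! ## Ranks of frame systems -/

section Rank

variable {X : Scheme.{u}} {E : X.Modules}

/-- **Two frame systems of one module have the same rank at every point**: both frames restrict to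
the non-empty open `U_x ∩ U'_x ∋ x`, whose ring of sections is non-trivial, and free modules of finite
rank over a non-trivial commutative ring have a well-defined rank (`rank_eq_of_nontrivial`). [folklore] -/
theorem frameSystem_rank_eq (F F' : FrameSystem E) (x : X) : F.rank x = F'.rank x := by
  haveI : Nonempty ↥(F.U x ⊓ F'.U x) := ⟨⟨x, ⟨F.mem x, F'.mem x⟩⟩⟩
  exact rank_eq_of_nontrivial (F.frame x) (F'.frame x) (F.enum x) (F'.enum x)
    (homOfLE (inf_le_left : F.U x ⊓ F'.U x ≤ F.U x)) (homOfLE (inf_le_right : F.U x ⊓ F'.U x ≤ F'.U x))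

variable {Y : Scheme.{u}} (f : Y ⟶ X)

/-- **Rank descends along a surjective morphism (frame-system form)**: if `f` is surjective on points
and `f^* E` carries a frame system of constant rank `r`, then every frame system of `E` has constant
rank `r` (compare the pulled-back frame system, `FrameSystem.pullback_rank`, at a preimage). [folklore] -/
theorem frameSystem_rank_eq_of_surjective (hf : Function.Surjective f.base) (F : FrameSystem E)
    (G : FrameSystem ((Scheme.Modules.pullback f).obj E)) {r : ℕ} (hG : ∀ y, G.rank y = r) (x : X) :
    F.rank x = r := by
  obtain ⟨y, rfl⟩ := hf x
  rw [← F.pullback_rank f y, frameSystem_rank_eq (F.pullback f) G y, hG y]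

/-- **Rank descends along a surjective morphism**: if `f : Y ⟶ X` is surjective on points, `E` is
finite locally free on `X` and `f^* E` has rank `r`, then `E` has rank `r`. In particular a finite
locally free lift of a rank-`r` bundle across a (surjective) closed immersion, e.g. a nilpotent
thickening `X_k ↪ X_{n+1}`, has rank `r`. [folklore] -/
theorem hasRank_of_hasRank_pullback_of_surjective (hf : Function.Surjective f.base)
    (hE : IsFiniteLocallyFree E) {r : ℕ} (hr : HasRank ((Scheme.Modules.pullback f).obj E) r) :
    HasRank E r := by
  obtain ⟨G, hG⟩ := exists_frameSystem_of_hasRank hr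
  exact (frameSystemOfIsFiniteLocallyFree hE).hasRank r
    (frameSystem_rank_eq_of_surjective f hf (frameSystemOfIsFiniteLocallyFree hE) G hG)

/-- **Rank is invariant under isomorphism** (transport a frame system of constant rank along
`E ≅ E'`, restricting the isomorphism to the opens of the frames). [folklore] -/
theorem hasRank_of_iso {E' : X.Modules} (e : E ≅ E') {r : ℕ} (h : HasRank E r) : HasRank E' r := by
  obtain ⟨F, hF⟩ := exists_frameSystem_of_hasRank h
  exact FrameSystem.hasRank
    { U := F.U
      mem := F.mem
      I := F.I
      rank := F.rank
      enum := F.enum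
      frame := fun x => F.frame x ≪≫ (Scheme.Modules.overFunctor (F.U x)).mapIso e } r hF

end Rank

/-! ## Ranks of lifts across the `p`-adic thickenings -/

section Thickening

open Literature.AlgebraicGeometry.Motives.WittScheme

variable {p : ℕ} [Fact p.Prime] {k : Type} [CommRing k] [CharP k p]
  (𝒳 : SchemeOver (WittVector p k))

/-- **`X_k ⟶ X_{n+1}` is surjective on points**: `X_{n+1} ⟶ 𝒳` is injective with the same image as
`X_k ⟶ 𝒳` (both are the zero locus of `p`, `range_thickeningι_succ_eq_range_specialFibreι`), and
`X_k ⟶ X_{n+1} ⟶ 𝒳` is `X_k ⟶ 𝒳`. (A private copy, over any `k` of characteristic `p`, of the lemma of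
the same name in `…FormalLiftingFromClassLiftingTowerCocycles`, stated there for perfect fields.) [folklore] -/
private theorem surjective_specialFibreToThickening_base' (n : ℕ) :
    Function.Surjective (specialFibreToThickening 𝒳 n).base := by
  intro z
  have hz : (thickeningι 𝒳 (n + 1)).base z ∈ Set.range (specialFibreι 𝒳) := by
    rw [← range_thickeningι_succ_eq_range_specialFibreι 𝒳 n]
    exact ⟨z, rfl⟩
  obtain ⟨y, hy⟩ := hz
  refine ⟨y, (isClosedEmbedding_thickeningι 𝒳 (n + 1)).injective ?_⟩
  rw [← Scheme.Hom.comp_apply, specialFibreToThickening_ι]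
  exact hy

/-- **Lifts keep the rank**: a finite locally free `F` on the thickening `X_{n+1}` whose restriction to
the special fibre is isomorphic to a rank-`r` module `E₁` has rank `r`. [folklore] -/
theorem hasRank_of_pullback_specialFibreToThickening_iso (n : ℕ)
    {F : (thickening 𝒳 (n + 1)).left.Modules} (hF : IsFiniteLocallyFree F)
    {E₁ : (specialFibre 𝒳).left.Modules} {r : ℕ} (h1 : HasRank E₁ r)
    (e : (Scheme.Modules.pullback (specialFibreToThickening 𝒳 n)).obj F ≅ E₁) : HasRank F r :=
  hasRank_of_hasRank_pullback_of_surjective _ (surjective_specialFibreToThickening_base' 𝒳 n) hF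
    (hasRank_of_iso e.symm h1)

end Thickening

/-! ## S6 in rank one -/

section RankOne

variable {Y Z : Scheme.{u}} (f : Y ⟶ Z) {F : Y.Modules}

/-- **A rank-one bundle whose determinant class extends is a pull-back (object form)**: if `F` is
finite locally free of rank `1` on `Y` and `c' ∈ Ȟ¹(Z, 𝒪_Z^×)` pulls back to `det[F]`, then for any
cocycle `c` representing `c'` the glued line bundle `lineBundle c` on `Z` pulls back to `F`:
`f^*(lineBundle c) ≅ F` — the pulled-back frame system of `lineBundle c` has the pulled-back cocycle
(`FrameSystem.pullback_cocycle_equiv`), of class `f^* c' = det[F]`, the class of any rank-one frame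
system of `F` (`detClass_eq_mk`), and rank-one framed modules with the same class are isomorphic
(`nonempty_iso_of_cocycle_equiv`). [cite: Hartshorne1977, III Ex. 4.5] -/
theorem nonempty_pullback_lineBundle_iso (hF : IsFiniteLocallyFree F) (h1 : HasRank F 1)
    (c : UnitCocycle Z) (hc : CechPic.pullback f (CechPic.mk c) = detClass hF) :
    Nonempty ((Scheme.Modules.pullback f).obj (lineBundle c) ≅ F) := by
  obtain ⟨FL, hFL⟩ := exists_frameSystem_of_hasRank h1
  have hclass : CechPic.mk ((c.lineBundleFrameSystem.pullback f).cocycle) = CechPic.mk FL.cocycle := by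
    rw [CechPic.sound (c.lineBundleFrameSystem.pullback_cocycle_equiv f), ← CechPic.pullback_mk,
      c.mk_lineBundleFrameSystem_cocycle, hc, ← detClass_eq_mk hF FL]
  exact nonempty_iso_of_cocycle_equiv (c.lineBundleFrameSystem.pullback f) FL (fun _ => rfl) hFL hclass

/-- **Object form of S6 in rank one**: a rank-`1` finite locally free `F` on `Y` whose determinant
class is the restriction of a class on `Z` is itself the restriction of a rank-`1` line bundle on `Z`.
[cite: Hartshorne1977, III Ex. 4.5] -/
theorem exists_lineBundle_pullback_iso_of_detClass_extends (hF : IsFiniteLocallyFree F)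
    (h1 : HasRank F 1) (hc : ∃ c' : CechPic Z, CechPic.pullback f c' = detClass hF) :
    ∃ L' : Z.Modules, HasRank L' 1 ∧ IsFiniteLocallyFree L' ∧
      Nonempty ((Scheme.Modules.pullback f).obj L' ≅ F) := by
  obtain ⟨c', hc'⟩ := hc
  obtain ⟨c, rfl⟩ := CechPic.mk_surjective c'
  exact ⟨lineBundle c, c.hasRank_lineBundle, c.isFiniteLocallyFree_lineBundle,
    nonempty_pullback_lineBundle_iso f hF h1 c hc'⟩

/-- **S6 (`stub_stepClassLiftingFromDetClass`) IN RANK ONE — step class lifting from the determinant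
class for line bundles**: for any morphism of schemes `f : Y ⟶ Z` and any finite locally free `F` of
rank `1` on `Y`, if `det[F] = f^* c'` for some `c' ∈ Ȟ¹(Z, 𝒪_Z^×)` then `[F] = f^* y` in `K₀(Y)` for some
`y ∈ K₀(Z)` — namely `y = [lineBundle c]`, `c` a cocycle of `c'` (`KZero.map_of`, `KZero.of_iso`). No
hypothesis of the crux is needed in rank one; the content of S6 is in ranks `≥ 2`.
[cite: Hartshorne1977, II Ex. 6.11] [cite: Fulton1998, §15.1] -/
theorem stepClassLifting_of_detClass_extends_of_hasRank_one :
    ∀ (Y Z : AlgebraicGeometry.Scheme.{0}) (f : Y ⟶ Z) (F : Y.Modules)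
      (hF : Literature.AlgebraicGeometry.Motives.IsFiniteLocallyFree F),
      Literature.AlgebraicGeometry.Motives.HasRank F 1 →
      (∃ c' : Literature.AlgebraicGeometry.Modules.CechPic Z,
        Literature.AlgebraicGeometry.Modules.CechPic.pullback f c' =
          Literature.AlgebraicGeometry.Modules.detClass hF) →
      ∃ y : Literature.AlgebraicGeometry.KTheory.KZero Z,
        Literature.AlgebraicGeometry.KTheory.KZero.map f y =
          Literature.AlgebraicGeometry.KTheory.KZero.of F hF := by
  intro Y Z f F hF h1 hc
  obtain ⟨L', -, hL', ⟨e⟩⟩ := exists_lineBundle_pullback_iso_of_detClass_extends f hF h1 hc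
  exact ⟨KZero.of L' hL', by rw [KZero.map_of, KZero.of_iso e (hL'.pullback f) hF]⟩

end RankOne

end Summit.HodgeConjecture.HodgeConjecture.Theorems.FormalLiftingFromClassLifting.WeightOne

end
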